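import Literature.Geometry.Riemannian.SimpleAHBoundarySphereProofs
import Literature.Geometry.Riemannian.CutLocusBishopExp
import Literature.Geometry.Riemannian.ExpMapHopfRinow
import Literature.Geometry.Riemannian.CartanHadamardExp
import Mathlib.Topology.Homotopy.Lifting
import HarnessLib

/-!
# Cartan–Hadamard manifolds: `exp_p` is a diffeomorphism, every geodesic segment minimises, and
# geodesic chords of a convex body into its interior run through the interior

Helper file for route InformationMetricHadamard, items `ConvexEndRecognition`
(stmt-SmoothPoincare4-6017) and `HadamardConvexBoundarySphere` (stmt-SmoothPoincare4-6016).
For a simply connected, geodesically complete Riemannian manifold with `Rm(X,Y,Y,X) ≤ 0`: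

* `expMap_injective`, `exists_expDiffeomorph`: `exp_p : T_pM → M` is injective (the tree's
  Cartan–Hadamard covering `SimpleAH.exp_covering_of_complete` plus Mathlib's lifting criterion for
  simply connected bases), hence a diffeomorphism `T_pM ≅ M` (Lee 2018, Thm. 12.8).
* `isMinimizingUpTo_one`, `edist_expMap_eq`: every radial segment `γ_v|[0,1]` is minimizing,
  `d(p, exp_p v) = |v|` (Hopf–Rinow minimiser + uniqueness of the geodesic).
* `edist_expMap_smul_add`: the points `exp_p (s v)`, `0 ≤ s ≤ 1`, lie metrically between `p` and
  `exp_p v`.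
* `expMap_smul_mem_interior`: for a set `K` which is convex in the betweenness sense, `p ∈ K` and
  `exp_p w ∈ interior K` force `exp_p (s w) ∈ interior K` for `0 < s ≤ 1` (the open-cone lemma).
* `expMap_neg_smul_velocity`: reversing a radial geodesic from `o`.

Everything is proved; no definitions, no named facts.

References: J. M. Lee, *Introduction to Riemannian Manifolds* (2018), Thm. 12.8, Prop. 5.19,
Cor. 6.21; A. Hatcher, *Algebraic Topology* (2002), Prop. 1.33–1.34.
-/

noncomputable section

-- the registered namespace `Summit.SmoothPoincare4.SmoothPoincare4.Theorems` repeats a component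
set_option linter.dupNamespace false

open Bundle Set Filter Function TopologicalSpace
open scoped Manifold ContDiff Topology ENNReal Pointwise

namespace Summit.SmoothPoincare4.SmoothPoincare4.Theorems.HadamardConvex

open Literature.Geometry.Lorentzian Literature.Geometry.Lorentzian.PseudoRiemannianMetric
  Literature.Geometry.Riemannian Literature.Geometry.Riemannian.SimpleAH

set_option maxSynthPendingDepth 3

variable {E : Type*} [NormedAddCommGroup E] [NormedSpace ℝ E] {H : Type*} [TopologicalSpace H]
  {I : ModelWithCorners ℝ E H} {M : Type*} [TopologicalSpace M] [ChartedSpace H M]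
  [IsManifold I ∞ M] [FiniteDimensional ℝ E] [CompleteSpace E] [T2Space M] [I.Boundaryless]
  [SimplyConnectedSpace M] [LocallyPathConnectedSpace M]
  {g : PseudoRiemannianMetric I ∞ E (TangentSpace I : M → Type _)} [g.HasLeviCivita]
  [CovariantDerivative.ContMDiffCovariantDerivative g.leviCivita 1]
  [CovariantDerivative.ContMDiffCovariantDerivative g.leviCivita ∞]

/-- **Cartan–Hadamard, simply connected case: `exp_p` is injective** (Lee 2018, Thm. 12.8: "if
`M` is simply connected, then `M` itself is diffeomorphic to `ℝⁿ`"). The covering map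
`exp_p : T_pM → M` (`SimpleAH.exp_covering_of_complete`) over the simply connected, locally
path-connected base `M` admits a global section through `0 ↦ p` (Mathlib's lifting criterion
`IsCoveringMap.existsUnique_continuousMap_lifts`), and `section ∘ exp_p = id` by uniqueness of
lifts from the connected space `T_pM` (Hatcher, Prop. 1.34). [cite: Lee2018, Thm. 12.8] -/
theorem expMap_injective (hg : g.IsRiemannian) (hc : IsGeodesicallyComplete g.leviCivita)
    (hsec : ∀ (x : M) (X Y : TangentSpace I x), g.curvatureForm g.leviCivita x X Y Y X ≤ 0)
    (p : M) : Injective (fun u : E ↦ expMap g.leviCivita p (show TangentSpace I p from u)) := by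
  obtain ⟨hFs, -, -, hFcov⟩ := exp_covering_of_complete hg hc hsec p
  set F : E → M := fun u ↦ expMap g.leviCivita p (show TangentSpace I p from u) with hFdef
  have hF0 : F 0 = p := expMap_zero (cov := g.leviCivita) p
  obtain ⟨s, ⟨hs0, hFs_id⟩, -⟩ :=
    hFcov.existsUnique_continuousMap_lifts (ContinuousMap.id M) p 0 hF0
  have hcomp : (s : M → E) ∘ F = id := by
    refine hFcov.eq_of_comp_eq (s.continuous.comp hFs.continuous) continuous_id ?_ 0 ?_
    · funext u
      have h := congr_fun hFs_id (F u)
      simpa [Function.comp] using h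
    · simp only [Function.comp_apply, hF0, hs0, id_eq]
  intro u v huv
  have h := congr_fun hcomp u
  have h' := congr_fun hcomp v
  simp only [Function.comp_apply, id_eq] at h h'
  rw [← h, ← h', show F u = F v from huv]

/-- **Cartan–Hadamard, simply connected case: `exp_p : T_pM ≅ M` is a diffeomorphism** (Lee 2018,
Thm. 12.8): the bijective local diffeomorphism `exp_p` (`exp_covering_of_complete`,
`expMap_injective`) packaged by Mathlib's `IsLocalDiffeomorph.diffeomorphOfBijective`.
[cite: Lee2018, Thm. 12.8] -/
theorem exists_expDiffeomorph (hg : g.IsRiemannian) (hc : IsGeodesicallyComplete g.leviCivita)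
    (hsec : ∀ (x : M) (X Y : TangentSpace I x), g.curvatureForm g.leviCivita x X Y Y X ≤ 0)
    (p : M) : ∃ Φ : E ≃ₘ^∞⟮𝓘(ℝ, E), I⟯ M,
      (Φ : E → M) = fun u : E ↦ expMap g.leviCivita p (show TangentSpace I p from u) := by
  obtain ⟨-, hFloc, hFsurj, -⟩ := exp_covering_of_complete hg hc hsec p
  exact ⟨hFloc.diffeomorphOfBijective ⟨expMap_injective hg hc hsec p, hFsurj⟩, rfl⟩

/-- **In a Cartan–Hadamard manifold every radial geodesic segment is minimizing** (Lee 2018,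
Prop. 12.9 (c) / Cor. 6.21): `γ_v|[0,1]` realises `d(p, exp_p v)`. The Hopf–Rinow minimiser from
`p` to `exp_p v` (`exists_isMinimizingUpTo_of_isGeodesicallyComplete`) has initial velocity `v` by
injectivity of `exp_p`. [cite: Lee2018, Prop. 12.9] -/
theorem isMinimizingUpTo_one (hg : g.IsRiemannian) (hc : IsGeodesicallyComplete g.leviCivita)
    (hsec : ∀ (x : M) (X Y : TangentSpace I x), g.curvatureForm g.leviCivita x X Y Y X ≤ 0)
    (p : M) (v : TangentSpace I p) : IsMinimizingUpTo g hg p v 1 := by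
  obtain ⟨w, hmin, hwq⟩ := exists_isMinimizingUpTo_of_isGeodesicallyComplete g le_rfl hg hc p
    (expMap g.leviCivita p v)
  have hwv : w = v := expMap_injective hg hc hsec p hwq
  rwa [hwv] at hmin

/-- `d(p, exp_p v) = |v|_g` in a Cartan–Hadamard manifold (Lee 2018, Prop. 12.9 with p. 308).
[cite: Lee2018, Prop. 12.9] -/
theorem edist_expMap_eq (hg : g.IsRiemannian) (hc : IsGeodesicallyComplete g.leviCivita)
    (hsec : ∀ (x : M) (X Y : TangentSpace I x), g.curvatureForm g.leviCivita x X Y Y X ≤ 0)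
    (p : M) (v : TangentSpace I p) :
    g.edist hg p (expMap g.leviCivita p v) = ENNReal.ofReal (Real.sqrt (g.val p v v)) :=
  edist_eq_of_isMinimizingUpTo hg hc (isMinimizingUpTo_one hg hc hsec p v)

/-- **Radial segments are metric segments**: for `0 ≤ s ≤ 1`,
`d(p, exp_p (s v)) + d(exp_p (s v), exp_p v) = d(p, exp_p v)` (Lee 2018, proof of Prop. 10.32 (a),
through the tree's `edist_expMap_smul_of_isMinimizingUpTo`). [cite: Lee2018, Prop. 10.32] -/
theorem edist_expMap_smul_add (hg : g.IsRiemannian) (hc : IsGeodesicallyComplete g.leviCivita)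
    (hsec : ∀ (x : M) (X Y : TangentSpace I x), g.curvatureForm g.leviCivita x X Y Y X ≤ 0)
    (p : M) (v : TangentSpace I p) {s : ℝ} (hs0 : 0 ≤ s) (hs1 : s ≤ 1) :
    g.edist hg p (expMap g.leviCivita p (s • v)) +
        g.edist hg (expMap g.leviCivita p (s • v)) (expMap g.leviCivita p v) =
      g.edist hg p (expMap g.leviCivita p v) := by
  have hmin := isMinimizingUpTo_one hg hc hsec p v
  have h := edist_expMap_smul_of_isMinimizingUpTo hg hc hmin
  have h0 : (0 : ℝ) ∈ Icc (0 : ℝ) 1 := ⟨le_rfl, zero_le_one⟩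
  have h1 : (1 : ℝ) ∈ Icc (0 : ℝ) 1 := ⟨zero_le_one, le_rfl⟩
  have hsI : s ∈ Icc (0 : ℝ) 1 := ⟨hs0, hs1⟩
  have ha := h 0 h0 s hsI
  have hb := h s hsI 1 h1
  simp only [riemannianExpMap_eq, zero_smul, one_smul, zero_sub, abs_neg] at ha hb
  rw [expMap_zero] at ha
  rw [ha, hb, ← add_mul, abs_of_nonneg hs0, abs_of_nonpos (by linarith), neg_sub,
    ← ENNReal.ofReal_add hs0 (by linarith), show s + (1 - s) = 1 by ring, ENNReal.ofReal_one,
    one_mul]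

/-- **The open-cone lemma for convex bodies.** Let `K ⊆ M` be convex in the betweenness sense
(`d(a, m) + d(m, b) = d(a, b)` with `a, b ∈ K` forces `m ∈ K`). If `p ∈ K` and `exp_p w` is an
interior point of `K`, then so is `exp_p (s w)` for every `0 < s ≤ 1`: the open set
`s • {w' | exp_p w' ∈ interior K}` is mapped by the open map `exp_p` into `K` (radial segments are
metric segments, `edist_expMap_smul_add`), hence into `interior K`. This is the synthetic form of
"a convex body contains the cone from a boundary point over an interior ball" (Eberlein–O'Neill
1973, §1; Lee 2018, Ch. 12). [cite: Lee2018, Prop. 12.9] -/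
theorem expMap_smul_mem_interior (hg : g.IsRiemannian) (hc : IsGeodesicallyComplete g.leviCivita)
    (hsec : ∀ (x : M) (X Y : TangentSpace I x), g.curvatureForm g.leviCivita x X Y Y X ≤ 0)
    {K : Set M}
    (hK : ∀ a ∈ K, ∀ b ∈ K, ∀ m : M, g.edist hg a m + g.edist hg m b = g.edist hg a b → m ∈ K)
    {p : M} (hp : p ∈ K) {w : TangentSpace I p} (hw : expMap g.leviCivita p w ∈ interior K)
    {s : ℝ} (hs0 : 0 < s) (hs1 : s ≤ 1) :
    expMap g.leviCivita p (s • w) ∈ interior K := by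
  obtain ⟨hFs, hFloc, -, -⟩ := exp_covering_of_complete hg hc hsec p
  set F : E → M := fun u ↦ expMap g.leviCivita p (show TangentSpace I p from u) with hFdef
  -- the open set of vectors aimed at the interior, and its dilate by `s`
  set U : Set E := F ⁻¹' interior K with hU
  have hUo : IsOpen U := isOpen_interior.preimage hFs.continuous
  have hsU : IsOpen (s • U) := hUo.smul₀ hs0.ne'
  -- its image lies in `K` by convexity
  have himK : F '' (s • U) ⊆ K := by
    rintro _ ⟨_, ⟨w', hw', rfl⟩, rfl⟩
    have hw'K : F w' ∈ K := interior_subset hw'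
    exact hK p hp (F w') hw'K _ (edist_expMap_smul_add hg hc hsec p w' hs0.le hs1)
  have himo : IsOpen (F '' (s • U)) := hFloc.isOpenMap _ hsU
  have hsub : F '' (s • U) ⊆ interior K := interior_maximal himK himo
  exact hsub ⟨s • (show E from w), Set.smul_mem_smul_set hw, rfl⟩

omit [SimplyConnectedSpace M] [LocallyPathConnectedSpace M]
  [CovariantDerivative.ContMDiffCovariantDerivative g.leviCivita ∞] in
/-- **Reversing a radial geodesic** (Lee 2018, Lemma 5.18 and the flow property of geodesics,
O'Neill 1983, Ch. 3, Lemma 22): with `γ = γ_v` the geodesic from `o` and `b ∈ ℝ`, the vector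
`w = -(b γ'(b)) ∈ T_{γ b}M` satisfies `exp_{γ b} (s w) = exp_o ((b (1 - s)) v)` for all `s`; in
particular `exp_{γ b} w = o`. [cite: Lee2018, Lemma 5.18] -/
theorem expMap_neg_smul_velocity (hc : IsGeodesicallyComplete g.leviCivita) (o : M)
    (v : TangentSpace I o) (b s : ℝ) :
    expMap g.leviCivita (maximalGeodesic g.leviCivita o v b)
        (s • -(b • velocity I (maximalGeodesic g.leviCivita o v) b)) =
      expMap g.leviCivita o ((b * (1 - s)) • v) := by
  set γ := maximalGeodesic g.leviCivita o v with hγ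
  rw [expMap_smul hc, expMap_smul hc, show -(b • velocity I γ b) = (-b) • velocity I γ b by
    rw [neg_smul], maximalGeodesic_smul hc]
  have h := maximalGeodesic_tangentLift_apply hc (⟨o, v⟩ : TangentBundle I M) b (-b * s)
  simp only [tangentLift_proj, tangentLift_snd] at h
  change maximalGeodesic g.leviCivita (γ b) (velocity I γ b) (-b * s) = γ (-b * s + b) at h
  rw [h, show -b * s + b = b * (1 - s) by ring]

omit [SimplyConnectedSpace M] [LocallyPathConnectedSpace M]
  [CovariantDerivative.ContMDiffCovariantDerivative g.leviCivita ∞] in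
/-- The reversed radial geodesic ends at the centre: `exp_{γ_v b} (-(b γ_v'(b))) = o`.
[cite: Lee2018, Lemma 5.18] -/
theorem expMap_neg_velocity (hc : IsGeodesicallyComplete g.leviCivita) (o : M)
    (v : TangentSpace I o) (b : ℝ) :
    expMap g.leviCivita (maximalGeodesic g.leviCivita o v b)
        (-(b • velocity I (maximalGeodesic g.leviCivita o v) b)) = o := by
  have h := expMap_neg_smul_velocity hc o v b 1
  rw [one_smul, sub_self, mul_zero, zero_smul, expMap_zero] at h
  exact h

end Summit.SmoothPoincare4.SmoothPoincare4.Theorems.HadamardConvex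

end
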